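import Literature.Probability.RandomPlanarGeometry.HullRestrictionSLEHolds
import Literature.Probability.RandomPlanarGeometry.LoewnerSemigroup
import Literature.Probability.RandomPlanarGeometry.RestrictionPullback
import HarnessLib

/-!
# Stub `stub_flatBoundaryScaling` of line `pin-the-shear` (crux stmt-CriticalPhenomena-14221,
# `Theses.SAWPhaseRetrieval.HexTransfer`)

**Boundary scaling of restriction probabilities at a flat marked point.** Let the Dobrushin
domain `F` coincide with the upper half-plane `ℍ` near its first marked point `a = 0`, and suppose
every chordal uniformizing map `φ : ℍ → F` is asymptotically linear at `0` (`φ z / z → c > 0`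
within `ℍ`, `φ⁻¹ w / w → c⁻¹` within `F`). Let `μ` be a chordal SLE(8/3) law of `F`, `K₁`, `K₂`
`*`-hulls with restriction maps of derivatives `d₁`, `d₂` at `0`, and `K` a compact subset of `ℍ̄`
with room `θ > 0`: the `θ`-neighbourhood of `K₁` in `ℍ̄` lies in `K` and that of `K` in `K₂`. Then
for all small `ε > 0`, `d₂^{5/8} ≤ μ {curves avoiding ε K} ≤ d₁^{5/8}`.

Proof. Write `μ` as the law of `Γ = φ(γ)`, `γ` the SLE(8/3) trace (a.s. simple and inside `ℍ` for
positive times, Rohde–Schramm Thm. 6.1, `ae_isSimpleTrace_sleTrace_of_hasSLETrace`), `φ` a chordal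
uniformizing map of `F`. For `ε` small the asymptotic linearity of `φ⁻¹` (resp. `φ`) at `0` gives
`{γ ∩ (ε/c) K₂ = ∅} ⊆ {Γ avoids ε K}` (resp. `{Γ avoids ε K} ⊆ {γ ∩ (ε/c) K₁ = ∅}`, using that
`F` is `ℍ` near `0`), and the outer events have pre-Wiener mass `d₂^{5/8}`, `d₁^{5/8}` by [LSW]
Thm. 6.1 in the half-plane (`sle_restriction_eightThirds_holds`, a theorem of the tree) applied to
the dilated hulls `(ε/c) Kᵢ` (`IsStarHull.smul`, `IsRestrictionMap.smulHull`,
`HasRestrictionDeriv.smulHull`: `Φ'_{rA}(0) = Φ'_A(0)`).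

* `exists_norm_sub_mul_le_of_tendsto_div` : `f z / z → c` gives `‖f z − c z‖ ≤ η ‖z‖` near `0`;
* `apply_mem_image_of_mem_smul`, `mem_smul_of_apply_mem_image` : the two deterministic inclusions;
* `mk_mem_rangeSubset_compl_of_disjoint`, `disjoint_of_mk_mem_rangeSubset_compl` : their lift to
  the compactified image curve;
* `stub_flatBoundaryScaling` : the registered stub, verbatim.
-/

noncomputable section

namespace Summit.CriticalPhenomena.SAWScalingLimit.Cruxes.HexTransfer.PinTheShear

open MeasureTheory Filter Topology Set
open scoped NNReal ENNReal Pointwise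
open Literature.Probability.RandomPlanarGeometry
open Literature.Probability (Process.preWienerMeasure)
open UpperHalfPlane (upperHalfPlaneSet)

/-! ### Elementary estimates -/

/-- If `f z / z → c` as `z → 0` within `S ∌ 0`, then for every `η > 0` there is `δ > 0` with
`‖f z − c z‖ ≤ η ‖z‖` for `z ∈ S`, `‖z‖ < δ`. [folklore] -/
theorem exists_norm_sub_mul_le_of_tendsto_div {f : ℂ → ℂ} {S : Set ℂ} {c : ℂ} (h0 : (0 : ℂ) ∉ S)
    (h : Tendsto (fun z => f z / z) (𝓝[S] 0) (𝓝 c)) {η : ℝ} (hη : 0 < η) :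
    ∃ δ > 0, ∀ z ∈ S, ‖z‖ < δ → ‖f z - c * z‖ ≤ η * ‖z‖ := by
  obtain ⟨δ, hδ, hδ'⟩ := Metric.tendsto_nhdsWithin_nhds.1 h η hη
  refine ⟨δ, hδ, fun z hz hzδ => ?_⟩
  have hz0 : z ≠ 0 := fun h => h0 (h ▸ hz)
  have h1 : dist (f z / z) c < η := hδ' hz (by rwa [dist_zero_right])
  rw [dist_eq_norm] at h1
  have h2 : f z - c * z = (f z / z - c) * z := by
    rw [sub_mul, div_mul_cancel₀ (f z) hz0]
  rw [h2, norm_mul]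
  exact mul_le_mul_of_nonneg_right h1.le (norm_nonneg _)

/-- For `R, a > 0`: `ε R < a` for all small `ε > 0`. [folklore] -/
theorem eventually_nhdsGT_mul_lt {R a : ℝ} (hR : 0 < R) (ha : 0 < a) :
    ∀ᶠ ε : ℝ in 𝓝[>] 0, ε * R < a := by
  filter_upwards [Ioo_mem_nhdsGT (div_pos ha hR)] with ε hε
  exact (lt_div_iff₀ hR).1 hε.2

/-- Positive dilations preserve the open upper half-plane (pointwise form). [folklore] -/
theorem smul_mem_upperHalfPlaneSet {a : ℝ} (ha : 0 < a) {z : ℂ} (hz : z ∈ upperHalfPlaneSet) :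
    a • z ∈ upperHalfPlaneSet := by
  show 0 < (a • z).im
  rw [Complex.smul_im, smul_eq_mul]
  exact mul_pos ha hz

/-- The norm of `ε • u` for `ε > 0`, `‖u‖ ≤ R` is at most `ε R`. [folklore] -/
theorem norm_smul_le_of_norm_le {ε R : ℝ} (hε : 0 < ε) {u : ℂ} (hu : ‖u‖ ≤ R) :
    ‖ε • u‖ ≤ ε * R := by
  rw [norm_smul, Real.norm_of_nonneg hε.le]
  exact mul_le_mul_of_nonneg_left hu hε.le

/-! ### The two deterministic inclusions -/

/-- **Inner inclusion.** If `φ : ℍ → F` satisfies `‖φ z − c z‖ ≤ η ‖z‖` for `z ∈ ℍ`, `‖z‖ < δ`,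
`F` coincides with `ℍ` in the ball of radius `r₀` about `0`, the `θ`-neighbourhood of `K₁` in `ℍ̄`
lies in `K`, `K₁ ⊆ B(0, R)` and `η R / c < θ`, `ε R / c < δ`, `ε (R + θ) < r₀`, then `φ` maps
`ℍ ∩ (ε/c) K₁` into `ε K`. [folklore] -/
theorem apply_mem_image_of_mem_smul {F : DobrushinDomain}
    (φ : ConformalEquiv upperHalfPlaneSet F.carrier) {c η δ θ R ε r₀ : ℝ} (hc : 0 < c)
    (hε : 0 < ε) (hη : 0 < η)
    (hflat : F.carrier ∩ Metric.ball (0 : ℂ) r₀ = upperHalfPlaneSet ∩ Metric.ball (0 : ℂ) r₀)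
    (hlin : ∀ z ∈ upperHalfPlaneSet, ‖z‖ < δ → ‖φ z - (c : ℂ) * z‖ ≤ η * ‖z‖)
    {K₁ K : Set ℂ} (hRK : ∀ u ∈ K₁, ‖u‖ ≤ R)
    (hroom : Metric.thickening θ K₁ ∩ closure upperHalfPlaneSet ⊆ K)
    (hηθ : R / c * η < θ) (hεδ : ε * (R / c) < δ) (hεr₀ : ε * (R + θ) < r₀)
    {z : ℂ} (hz : z ∈ upperHalfPlaneSet) (hzK : z ∈ (ε / c) • K₁) :
    φ z ∈ (fun z : ℂ => (ε : ℂ) * z) '' K := by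
  obtain ⟨u, hu, rfl⟩ := Set.mem_smul_set.1 hzK
  have hR : 0 ≤ R := (norm_nonneg u).trans (hRK u hu)
  have hεc : 0 < ε / c := div_pos hε hc
  -- `‖z‖ ≤ ε R / c < δ`
  have hnz : ‖(ε / c) • u‖ ≤ ε * (R / c) := by
    refine (norm_smul_le_of_norm_le hεc (hRK u hu)).trans_eq ?_
    ring
  have h1 := hlin _ hz (hnz.trans_lt hεδ)
  have hcz : (c : ℂ) * ((ε / c) • u) = ε • u := by
    rw [← Complex.real_smul, smul_smul, mul_div_cancel₀ _ hc.ne']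
  rw [hcz] at h1
  -- the rescaled image point `y = φ z / ε` is `θ`-close to `u ∈ K₁`
  set y : ℂ := ε⁻¹ • φ ((ε / c) • u) with hy
  have hφy : φ ((ε / c) • u) = ε • y := by
    rw [hy, smul_inv_smul₀ hε.ne']
  have hdist' : ‖φ ((ε / c) • u) - ε • u‖ < ε * θ := by
    refine h1.trans_lt ?_
    calc η * ‖(ε / c) • u‖ ≤ η * (ε * (R / c)) := mul_le_mul_of_nonneg_left hnz hη.le
      _ = ε * (R / c * η) := by ring
      _ < ε * θ := mul_lt_mul_of_pos_left hηθ hε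
  have hdist : dist y u < θ := by
    have hyu : y - u = ε⁻¹ • (φ ((ε / c) • u) - ε • u) := by
      rw [smul_sub, inv_smul_smul₀ hε.ne', hy]
    rw [dist_eq_norm, hyu, norm_smul, norm_inv, Real.norm_of_nonneg hε.le, inv_mul_lt_iff₀ hε]
    exact hdist'
  -- `φ z ∈ F ∩ B(0, r₀) ⊆ ℍ`, so `y ∈ ℍ`
  have hnorm : ‖φ ((ε / c) • u)‖ < r₀ := by
    calc ‖φ ((ε / c) • u)‖ ≤ ‖φ ((ε / c) • u) - ε • u‖ + ‖ε • u‖ := norm_le_norm_sub_add _ _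
      _ < ε * θ + ε * R := add_lt_add_of_lt_of_le hdist' (norm_smul_le_of_norm_le hε (hRK u hu))
      _ = ε * (R + θ) := by ring
      _ < r₀ := hεr₀
  have hφH : φ ((ε / c) • u) ∈ upperHalfPlaneSet := by
    have hmem : φ ((ε / c) • u) ∈ F.carrier ∩ Metric.ball (0 : ℂ) r₀ :=
      ⟨φ.mapsTo hz, mem_ball_zero_iff.2 hnorm⟩
    rw [hflat] at hmem
    exact hmem.1
  have hyH : y ∈ upperHalfPlaneSet := smul_mem_upperHalfPlaneSet (inv_pos.2 hε) hφH
  have hyK : y ∈ K := hroom ⟨Metric.mem_thickening_iff.2 ⟨u, hu, hdist⟩, subset_closure hyH⟩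
  refine ⟨y, hyK, ?_⟩
  rw [hφy, Complex.real_smul]

/-- **Outer inclusion.** If `φ⁻¹ : F → ℍ` satisfies `‖φ⁻¹ w − c⁻¹ w‖ ≤ η ‖w‖` for `w ∈ F`,
`‖w‖ < δ`, the `θ`-neighbourhood of `K` in `ℍ̄` lies in `K₂`, `K ⊆ B(0, R)` and `R c η < θ`,
`ε R < δ`, then every `z ∈ ℍ` with `φ z ∈ ε K` lies in `(ε/c) K₂`. [folklore] -/
theorem mem_smul_of_apply_mem_image {F : DobrushinDomain}
    (φ : ConformalEquiv upperHalfPlaneSet F.carrier) {c η δ θ R ε : ℝ} (hc : 0 < c) (hε : 0 < ε)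
    (hη : 0 < η)
    (hlin : ∀ w ∈ F.carrier, ‖w‖ < δ → ‖φ.symm w - (c : ℂ)⁻¹ * w‖ ≤ η * ‖w‖)
    {K K₂ : Set ℂ} (hRK : ∀ u ∈ K, ‖u‖ ≤ R)
    (hroom : Metric.thickening θ K ∩ closure upperHalfPlaneSet ⊆ K₂)
    (hηθ : R * c * η < θ) (hεδ : ε * R < δ)
    {z : ℂ} (hz : z ∈ upperHalfPlaneSet) (hφz : φ z ∈ (fun z : ℂ => (ε : ℂ) * z) '' K) :
    z ∈ (ε / c) • K₂ := by
  obtain ⟨u, hu, hw⟩ := hφz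
  dsimp only at hw
  rw [← Complex.real_smul] at hw
  -- `w = φ z = ε u`, `‖w‖ ≤ ε R < δ`, so `‖z − c⁻¹ w‖ ≤ η ‖w‖`
  have hnw : ‖ε • u‖ ≤ ε * R := norm_smul_le_of_norm_le hε (hRK u hu)
  have h1 := hlin (ε • u) (hw ▸ φ.mapsTo hz) (hnw.trans_lt hεδ)
  have hsymm : φ.symm (ε • u) = z := by rw [hw, φ.symm_apply_apply hz]
  rw [hsymm] at h1
  have hεc : 0 < ε / c := div_pos hε hc
  -- the rescaled point `y = (c/ε) z` is `θ`-close to `u ∈ K`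
  set y : ℂ := (ε / c)⁻¹ • z with hy
  have hzy : z = (ε / c) • y := by rw [hy, smul_inv_smul₀ hεc.ne']
  have hcu : (ε / c) • u = (c : ℂ)⁻¹ * (ε • u) := by
    rw [Complex.real_smul, Complex.real_smul, Complex.ofReal_div]
    ring
  have hdist : dist y u < θ := by
    have hyu : y - u = (ε / c)⁻¹ • (z - (ε / c) • u) := by
      rw [smul_sub, inv_smul_smul₀ hεc.ne', hy]
    rw [dist_eq_norm, hyu, norm_smul, norm_inv, Real.norm_of_nonneg hεc.le, inv_mul_lt_iff₀ hεc,
      hcu]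
    refine h1.trans_lt ?_
    calc η * ‖ε • u‖ ≤ η * (ε * R) := mul_le_mul_of_nonneg_left hnw hη.le
      _ = ε / c * (R * c * η) := by field_simp
      _ < ε / c * θ := mul_lt_mul_of_pos_left hηθ hεc
  have hyH : y ∈ upperHalfPlaneSet := smul_mem_upperHalfPlaneSet (inv_pos.2 hεc) hz
  have hyK₂ : y ∈ K₂ := hroom ⟨Metric.mem_thickening_iff.2 ⟨u, hu, hdist⟩, subset_closure hyH⟩
  rw [hzy]
  exact Set.smul_mem_smul_set hyK₂

/-! ### Lifting to the compactified image curve -/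

section Curve

variable {F : DobrushinDomain} {φ : ConformalEquiv upperHalfPlaneSet F.carrier} {γ : ℝ≥0 → ℂ}
  {cc : Curve ℂ} {E A : Set ℂ}

/-- If `γ` (a path in `ℍ ∪ {0}` from `0`) avoids `A`, `b ∉ E`, `0 ∉ E` (`a = 0`) and every
`z ∈ ℍ` with `φ z ∈ E` lies in `A`, then the compactified image of `γ` under the chordal
uniformizing map `φ` avoids `E`. [folklore] -/
theorem mk_mem_rangeSubset_compl_of_disjoint (hφ : F.IsChordalUniformizing φ) (hF0 : F.pt 0 = 0)
    (h0 : γ 0 = 0) (hH : ∀ t, 0 < t → 0 < (γ t).im)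
    (hcc : IsCompactifiedImage φ.boundaryExtension γ (F.pt 1) cc) (hb : F.pt 1 ∉ E)
    (h0E : (0 : ℂ) ∉ E) (hkey : ∀ z ∈ upperHalfPlaneSet, φ z ∈ E → z ∈ A)
    (hdisj : Disjoint (range γ) A) :
    CurveClass.mk cc ∈ CurveClass.rangeSubset Eᶜ := by
  rw [CurveClass.mem_rangeSubset, CurveClass.range_mk]
  intro w hw hwE
  rcases hcc.mem_range_iff.1 hw with rfl | ⟨t, rfl⟩
  · exact hb hwE
  · rcases eq_or_ne t 0 with rfl | ht
    · rw [h0, hφ.boundaryExtension_zero, hF0] at hwE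
      exact h0E hwE
    · have ht' : 0 < t := pos_iff_ne_zero.2 ht
      rw [φ.boundaryExtension_eq (show γ t ∈ upperHalfPlaneSet from hH t ht')] at hwE
      exact Set.disjoint_left.1 hdisj (mem_range_self t) (hkey _ (hH t ht') hwE)

/-- If the compactified image of `γ` (a path in `ℍ ∪ {0}` from `0`) under `φ` avoids `E`,
`0 ∉ A` and `φ` maps `ℍ ∩ A` into `E`, then `γ` avoids `A`. [folklore] -/
theorem disjoint_of_mk_mem_rangeSubset_compl (h0 : γ 0 = 0) (hH : ∀ t, 0 < t → 0 < (γ t).im)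
    (hcc : IsCompactifiedImage φ.boundaryExtension γ (F.pt 1) cc) (h0A : (0 : ℂ) ∉ A)
    (hkey : ∀ z ∈ upperHalfPlaneSet, z ∈ A → φ z ∈ E)
    (hav : CurveClass.mk cc ∈ CurveClass.rangeSubset Eᶜ) : Disjoint (range γ) A := by
  rw [CurveClass.mem_rangeSubset, CurveClass.range_mk] at hav
  refine Set.disjoint_left.2 ?_
  rintro _ ⟨t, rfl⟩ htA
  rcases eq_or_ne t 0 with rfl | ht
  · exact h0A (h0 ▸ htA)
  · have ht' : 0 < t := pos_iff_ne_zero.2 ht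
    have hw : φ (γ t) ∈ cc.range := by
      rw [← φ.boundaryExtension_eq (show γ t ∈ upperHalfPlaneSet from hH t ht')]
      exact hcc.mem_range_iff.2 (Or.inr ⟨t, rfl⟩)
    exact hav hw (hkey _ (hH t ht') htA)

end Curve

/-! ### The stub -/

/-- **Boundary scaling of restriction probabilities at a flat marked point** (Stub 4a of line
`pin-the-shear`). For a Dobrushin domain `F` flat at its first marked point `a = 0`, all of whose
chordal uniformizing maps are asymptotically linear at `0`, a chordal SLE(8/3) law `μ` of `F`,
`*`-hulls `K₁ ⊆ K ⊆ K₂` with room `θ` in `ℍ̄` and restriction derivatives `d₁`, `d₂`: for all small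
`ε > 0`, `d₂^{5/8} ≤ μ {curves avoiding ε K} ≤ d₁^{5/8}` ([LSW] Thm. 6.1 in the half-plane,
`sle_restriction_eightThirds_holds`, sandwiched through the asymptotically linear uniformizer).
[cite: LawlerSchrammWerner2003Restriction, Thm. 6.1] -/
theorem stub_flatBoundaryScaling :
    ∀ (F : DobrushinDomain) (r₀ : ℝ), 0 < r₀ → F.pt 0 = 0 →
      F.carrier ∩ Metric.ball (0 : ℂ) r₀ =
        UpperHalfPlane.upperHalfPlaneSet ∩ Metric.ball (0 : ℂ) r₀ →
      (∀ φ : ConformalEquiv UpperHalfPlane.upperHalfPlaneSet F.carrier, F.IsChordalUniformizing φ →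
        ∃ c : ℝ, 0 < c ∧
          Tendsto (fun z : ℂ => φ z / z) (𝓝[UpperHalfPlane.upperHalfPlaneSet] 0) (𝓝 (c : ℂ)) ∧
          Tendsto (fun w : ℂ => φ.symm w / w) (𝓝[F.carrier] 0) (𝓝 ((c : ℂ)⁻¹))) →
      ∀ (μ : Measure (CurveClass ℂ)), IsSLELaw ((8 : ℝ≥0) / 3) F μ →
      ∀ (K₁ K K₂ : Set ℂ) (θ : ℝ), 0 < θ → IsStarHull K₁ → IsStarHull K₂ → IsCompact K →
        K ⊆ closure UpperHalfPlane.upperHalfPlaneSet →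
        Metric.thickening θ K₁ ∩ closure UpperHalfPlane.upperHalfPlaneSet ⊆ K →
        Metric.thickening θ K ∩ closure UpperHalfPlane.upperHalfPlaneSet ⊆ K₂ →
      ∀ (Φ₁ : ConformalEquiv (UpperHalfPlane.upperHalfPlaneSet \ K₁) UpperHalfPlane.upperHalfPlaneSet)
        (d₁ : ℝ), IsRestrictionMap K₁ Φ₁ → HasRestrictionDeriv K₁ Φ₁ d₁ →
      ∀ (Φ₂ : ConformalEquiv (UpperHalfPlane.upperHalfPlaneSet \ K₂) UpperHalfPlane.upperHalfPlaneSet)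
        (d₂ : ℝ), IsRestrictionMap K₂ Φ₂ → HasRestrictionDeriv K₂ Φ₂ d₂ →
      ∀ᶠ ε : ℝ in 𝓝[>] 0,
        ENNReal.ofReal (d₂ ^ ((5 : ℝ) / 8)) ≤
            μ (CurveClass.rangeSubset ((fun z : ℂ => (ε : ℂ) * z) '' K)ᶜ) ∧
          μ (CurveClass.rangeSubset ((fun z : ℂ => (ε : ℂ) * z) '' K)ᶜ) ≤
            ENNReal.ofReal (d₁ ^ ((5 : ℝ) / 8)) := by
  intro F r₀ hr₀ hF0 hflat hU μ hμ K₁ K K₂ θ hθ hK₁ hK₂ hKc hKsub hroom₁ hroom₂ Φ₁ d₁ hΦ₁ hd₁ Φ₂ d₂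
    hΦ₂ hd₂
  have hκ4 : (8 : ℝ≥0) / 3 ≤ 4 := by
    rw [div_le_iff₀ (by norm_num : (0 : ℝ≥0) < 3)]
    norm_num
  -- the SLE curve `Γ = φ(γ)` of `F` and the asymptotic linearity of `φ` at `0`
  obtain ⟨Γ, ⟨hΓm, φ, hφ, hΓae⟩, rfl⟩ := hμ
  obtain ⟨c, hc, hφlin, hφslin⟩ := hU φ hφ
  -- `K₁ ⊆ K ⊆ K₂ ⊆ B(0, R)`, `0 ∉ K`, `b ≠ 0`
  have hK₁K : K₁ ⊆ K := fun u hu =>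
    hroom₁ ⟨Metric.self_subset_thickening hθ _ hu, hK₁.isBoundedHull.subset_closure hu⟩
  have hKK₂ : K ⊆ K₂ := fun u hu => hroom₂ ⟨Metric.self_subset_thickening hθ _ hu, hKsub hu⟩
  have h0K : (0 : ℂ) ∉ K := fun h => hK₂.zero_notMem (hKK₂ h)
  obtain ⟨R, hR, hRK₂⟩ : ∃ R > 0, ∀ u ∈ K₂, ‖u‖ ≤ R := hK₂.isBoundedHull.1.exists_pos_norm_le
  have hRK : ∀ u ∈ K, ‖u‖ ≤ R := fun u hu => hRK₂ u (hKK₂ hu)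
  have hRK₁ : ∀ u ∈ K₁, ‖u‖ ≤ R := fun u hu => hRK u (hK₁K hu)
  have hb : F.pt 1 ≠ 0 := by
    rw [← hF0]
    exact fun h => absurd (F.pt_injective h) (by decide)
  -- the linear approximations of `φ` and `φ⁻¹` at `0`
  obtain ⟨η₁, hη₁, hη₁θ⟩ : ∃ η, 0 < η ∧ R / c * η < θ := exists_pos_mul_lt hθ _
  have h0H : (0 : ℂ) ∉ upperHalfPlaneSet := fun h => by simp at h
  obtain ⟨δ₁, hδ₁, hlin₁⟩ := exists_norm_sub_mul_le_of_tendsto_div h0H hφlin hη₁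
  obtain ⟨η₂, hη₂, hη₂θ⟩ : ∃ η, 0 < η ∧ R * c * η < θ := exists_pos_mul_lt hθ _
  have h0F : (0 : ℂ) ∉ F.carrier := hF0 ▸ F.pt_notMem_carrier 0
  obtain ⟨δ₂, hδ₂, hlin₂⟩ := exists_norm_sub_mul_le_of_tendsto_div h0F hφslin hη₂
  -- the good event: the trace is simple and `Γ` is its compactified image
  have hgood : ∀ᵐ ω ∂Process.preWienerMeasure, Loewner.IsSimpleTrace (sleTrace ((8 : ℝ≥0) / 3) ω) ∧
      ∃ cc : Curve ℂ, Γ ω = CurveClass.mk cc ∧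
        IsCompactifiedImage φ.boundaryExtension (sleTrace ((8 : ℝ≥0) / 3) ω) (F.pt 1) cc := by
    filter_upwards [ae_isSimpleTrace_sleTrace_of_hasSLETrace hasSLETrace_eightThirds hκ4, hΓae]
      with ω hs hω
    exact ⟨hs, hω.2⟩
  -- small `ε`
  have hev : ∀ᶠ ε : ℝ in 𝓝[>] 0, 0 < ε ∧ ε * R < ‖F.pt 1‖ ∧ ε * R < δ₂ ∧ ε * (R / c) < δ₁ ∧
      ε * (R + θ) < r₀ := by
    filter_upwards [eventually_mem_nhdsWithin, eventually_nhdsGT_mul_lt hR (norm_pos_iff.2 hb),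
      eventually_nhdsGT_mul_lt hR hδ₂, eventually_nhdsGT_mul_lt (div_pos hR hc) hδ₁,
      eventually_nhdsGT_mul_lt (add_pos hR hθ) hr₀] with ε h0 h1 h2 h3 h4
    exact ⟨h0, h1, h2, h3, h4⟩
  filter_upwards [hev] with ε ⟨hε, hεb, hεδ₂, hεδ₁, hεr₀⟩
  have hr : 0 < ε / c := div_pos hε hc
  -- [LSW] Thm. 6.1 for the dilated hulls `(ε/c) K₂`, `(ε/c) K₁`
  have hP₂ : Process.preWienerMeasure {ω | Disjoint (range (sleTrace ((8 : ℝ≥0) / 3) ω))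
      ((ε / c) • K₂)} = ENNReal.ofReal (d₂ ^ ((5 : ℝ) / 8)) :=
    sle_restriction_eightThirds_holds (hK₂.smul hr) (hΦ₂.smulHull hr) (hd₂.smulHull hr)
  have hP₁ : Process.preWienerMeasure {ω | Disjoint (range (sleTrace ((8 : ℝ≥0) / 3) ω))
      ((ε / c) • K₁)} = ENNReal.ofReal (d₁ ^ ((5 : ℝ) / 8)) :=
    sle_restriction_eightThirds_holds (hK₁.smul hr) (hΦ₁.smulHull hr) (hd₁.smulHull hr)
  -- the avoidance event is Borel (avoiding a closed set is open)
  have hEc : IsClosed ((fun z : ℂ => (ε : ℂ) * z) '' K) :=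
    (hKc.image (continuous_const_mul (ε : ℂ))).isClosed
  have hEm : MeasurableSet (CurveClass.rangeSubset ((fun z : ℂ => (ε : ℂ) * z) '' K)ᶜ) :=
    CurveClass.measurableSet_rangeSubset_compl hEc
  -- `b ∉ ε K`, `0 ∉ ε K`, `0 ∉ (ε/c) K₁`
  have hbE : F.pt 1 ∉ (fun z : ℂ => (ε : ℂ) * z) '' K := by
    rintro ⟨u, hu, hu'⟩
    dsimp only at hu'
    have h1 : ‖F.pt 1‖ ≤ ε * R := by
      rw [← hu', ← Complex.real_smul]
      exact norm_smul_le_of_norm_le hε (hRK u hu)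
    exact absurd hεb (not_lt.2 h1)
  have h0E : (0 : ℂ) ∉ (fun z : ℂ => (ε : ℂ) * z) '' K := by
    rintro ⟨u, hu, hu'⟩
    dsimp only at hu'
    rcases mul_eq_zero.1 hu' with h | h
    · exact hε.ne' (Complex.ofReal_eq_zero.1 h)
    · exact h0K (h ▸ hu)
  have h0A : (0 : ℂ) ∉ (ε / c) • K₁ := (hK₁.smul hr).zero_notMem
  rw [Measure.map_apply_of_aemeasurable hΓm hEm]
  refine ⟨?_, ?_⟩
  · -- `{γ ∩ (ε/c) K₂ = ∅} ⊆ {Γ avoids ε K}` a.s.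
    rw [← hP₂]
    refine measure_mono_ae (hgood.mono fun ω hω hdisj => ?_)
    obtain ⟨hsimple, cc, hΓω, hcc⟩ := hω
    show Γ ω ∈ _
    rw [hΓω]
    exact mk_mem_rangeSubset_compl_of_disjoint hφ hF0 (sleTrace_zero _ ω) hsimple.2 hcc hbE h0E
      (fun z hz hφz => mem_smul_of_apply_mem_image φ hc hε hη₂ hlin₂ hRK hroom₂ hη₂θ hεδ₂ hz hφz)
      hdisj
  · -- `{Γ avoids ε K} ⊆ {γ ∩ (ε/c) K₁ = ∅}` a.s.
    rw [← hP₁]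
    refine measure_mono_ae (hgood.mono fun ω hω hav => ?_)
    obtain ⟨hsimple, cc, hΓω, hcc⟩ := hω
    replace hav : Γ ω ∈ CurveClass.rangeSubset ((fun z : ℂ => (ε : ℂ) * z) '' K)ᶜ := hav
    rw [hΓω] at hav
    exact disjoint_of_mk_mem_rangeSubset_compl (sleTrace_zero _ ω) hsimple.2 hcc h0A
      (fun z hz hzK => apply_mem_image_of_mem_smul φ hc hε hη₁ hflat hlin₁ hRK₁ hroom₁ hη₁θ hεδ₁
        hεr₀ hz hzK) hav

end Summit.CriticalPhenomena.SAWScalingLimit.Cruxes.HexTransfer.PinTheShear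

end
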